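import Summits.NavierStokesRegularity.OSWSelfSimilar.SheetRSolutionOperator
import Summits.NavierStokesRegularity.OSWSelfSimilar.SheetREnergyClassBilinear
import Summits.NavierStokesRegularity.OSWSelfSimilar.SheetRWeakPairingExpansion
import Summits.NavierStokesRegularity.OSWSelfSimilar.CertificateViscousSheetR
import HarnessLib

/-!
# SHEET-ℝ frame, MODEL ASSEMBLY layer 4a: the certificate's nonlocal part `P`, quadratic part `Q` and residual as BOUNDED
# OPERATORS on the concrete Hilbert spaces `Esp L hL` (energy space) and `W L = L²_w` (pivot space)

HONEST FRAMING (cell ns-blowup GROUP B / zone Z3, case Z3-SR-CERT; 1-D MODEL certificate frame (viscous gCLM/OSW sheet on the line at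
`c_l = 1/2`); not Euler/NS; «violates: none — MODEL»). Nothing here asserts that a profile exists and no number of record moves.

The row theorem `CertificateViscousSheetR.existsUnique_fixedPoint_of_row_w` quantifies over an abstract Banach space `E`, a normed space
`W`, a solution operator `S : W →L E`, a bilinear `Q : E →L E →L W` and a residual `g₀ : W`.  Layers 3a–3e (selfsim g10) built the concrete
`E := Esp L hL`, `W := W L` and the solution operator of the COERCIVE part `B_λ`.  This file bundles the remaining function-level objects of
the frame (`CertificateViscousSheetR`, FRAME; PRICE-impl1 (C4)) as operators on those spaces, for a centre `Ω̄` in the odd energy class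
(`Ω̄ = ∫₀Ω̄₁`, `∫wΩ̄² < ∞`, `∫wΩ̄₁² < ∞`; the profile of `p ∈ Esp` is `u = prim (der p)`, `u₁ = der p`):

* §1–§2 — read-back lemmas: `‖toLp f‖ = (∫ w f²)^{1/2}` (`norm_toLp_W`), the comparison `weightedSq_le_of_sq_le`, and the profile of
  `p ∈ Esp` in the primitive form of record with `∫ w(u₁² + ¼u²) = ‖p‖²` (`profile_of_mem`);
* **`Pop`** `: Esp L hL →L[ℝ] W L`, `p ↦ λχ·u + Ω̄·Hu − a·Ω̄₁·𝒰u` (`χ = L²/(L²+ξ²)`, `H` the line Hilbert transform, `𝒰u = ∫₀Hu`) — the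
  certificate's `P` (`DG(Ω̄) = B_λ − P`), bounded by `2(|λ| + sup|Ω̄| + |a|(π/(4L))^{1/2}‖Ω̄₁‖_w)` via (E4)
  (`weightedSq_hilbertTransform_of_primitive`, `abs_velocity_le_of_primitive`);
* **`Qop`** `: Esp L hL →L[ℝ] Esp L hL →L[ℝ] W L`, `(p, q) ↦ a·𝒰u·v₁ − Hu·v` — the quadratic part, `‖Qop p q‖ ≤ M_w‖p‖‖q‖` with
  `M_w = 2|a|(π/(4L))^{1/2} + 2√2/L` (`SheetREnergyClass.sqrt_weightedSq_quadratic_le`);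
* the KERNEL inequality `4·M_w ≤ Llip` at the frame's `(L, a) = (8, 1/5)` (`four_Mw_le_Llip`; Mathlib's `π < 3.141593`).
Pointwise additivity of `H` and `𝒰` on the class is `SheetRWeakPairingExpansion.hilbertTransform_add_of_primitive` / `velocity_add_of_primitive`.
Two definitions (`Pop`, `Qop`), no named fact, no `Prop` hypothesis.  WHAT THIS IS NOT: not NS; not the interval arithmetic; the
composition with the solution operator and the row literals is `SheetRCertificateAssembly.lean`.
-/

noncomputable section

namespace Summit.NavierStokesRegularity.OSWSelfSimilar
namespace SheetRAssemblyOperators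

open _root_.MeasureTheory _root_.Set _root_.Filter _root_.Real Literature.Analysis.Fourier SheetRWeakProfilePV SheetRWeakToStrong
  SheetREnergyClass SheetRWeightedMeasure SheetREnergySpace SheetRSolutionOperator SheetRWeakPairingExpansion
open scoped Topology ENNReal

/-! ### §1 Elements of `W L` built from functions: norm read-back and a comparison lemma -/

section ToW

variable {L : ℝ}

/-- For `f ∈ L²(μ_w)` (`L > 0`): the class `toLp f` equals `f` Lebesgue-a.e. and `‖toLp f‖ = (∫ (L²+ξ²) f²)^{1/2}`. [folklore] -/
theorem norm_toLp_W (hL : 0 < L) {f : ℝ → ℝ} (hf : MemLp f 2 (μw L)) :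
    (((hf.toLp f : W L) : ℝ → ℝ) =ᵐ[volume] f) ∧ ‖(hf.toLp f : W L)‖ = Real.sqrt (∫ y, (L ^ 2 + y ^ 2) * f y ^ 2) := by
  have hae : ((hf.toLp f : W L) : ℝ → ℝ) =ᵐ[volume] f := ae_volume_of_ae_μw hL (MemLp.coeFn_toLp _)
  refine ⟨hae, ?_⟩
  rw [norm_W]
  exact congrArg _ (integral_congr_ae (hae.mono fun y hy => by simp only [hy]))

/-- Lebesgue-a.e. equal functions are `μ_w`-a.e. equal (`μ_w ≪ volume`). [folklore] -/
theorem ae_μw_of_ae_volume {f g : ℝ → ℝ} (hfg : f =ᵐ[volume] g) : f =ᵐ[μw L] g := by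
  have hac : μw L ≪ volume := by rw [μw_eq]; exact withDensity_absolutelyContinuous _ _
  exact hac.ae_le hfg

/-- **Comparison.** If `f² ≤ C²·g²` pointwise (`C ≥ 0`) with `f` a.e.-strongly measurable and `∫ w g² < ∞`, then `∫ w f² < ∞` and
`(∫ w f²)^{1/2} ≤ C·(∫ w g²)^{1/2}`. [folklore] -/
theorem weightedSq_le_of_sq_le {f g : ℝ → ℝ} {C : ℝ} (hfm : AEStronglyMeasurable f volume)
    (hg : Integrable fun y => (L ^ 2 + y ^ 2) * g y ^ 2) (hC : 0 ≤ C) (hle : ∀ y, f y ^ 2 ≤ C ^ 2 * g y ^ 2) :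
    Integrable (fun y => (L ^ 2 + y ^ 2) * f y ^ 2) ∧
      Real.sqrt (∫ y, (L ^ 2 + y ^ 2) * f y ^ 2) ≤ C * Real.sqrt (∫ y, (L ^ 2 + y ^ 2) * g y ^ 2) := by
  have hwm : AEStronglyMeasurable (fun y : ℝ => L ^ 2 + y ^ 2) volume := by fun_prop
  have hpt : ∀ y, (L ^ 2 + y ^ 2) * f y ^ 2 ≤ C ^ 2 * ((L ^ 2 + y ^ 2) * g y ^ 2) := fun y => by
    have hw : 0 ≤ L ^ 2 + y ^ 2 := by positivity
    nlinarith [mul_le_mul_of_nonneg_left (hle y) hw]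
  have hint : Integrable (fun y => (L ^ 2 + y ^ 2) * f y ^ 2) :=
    (hg.const_mul (C ^ 2)).mono' (hwm.mul (hfm.pow 2)) (Eventually.of_forall fun y => by
      rw [Real.norm_eq_abs, abs_of_nonneg (by positivity)]; exact hpt y)
  refine ⟨hint, ?_⟩
  have hle' : ∫ y, (L ^ 2 + y ^ 2) * f y ^ 2 ≤ C ^ 2 * ∫ y, (L ^ 2 + y ^ 2) * g y ^ 2 := by
    rw [← integral_const_mul]; exact integral_mono hint (hg.const_mul _) hpt
  calc Real.sqrt (∫ y, (L ^ 2 + y ^ 2) * f y ^ 2) ≤ Real.sqrt (C ^ 2 * ∫ y, (L ^ 2 + y ^ 2) * g y ^ 2) := Real.sqrt_le_sqrt hle'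
    _ = C * Real.sqrt (∫ y, (L ^ 2 + y ^ 2) * g y ^ 2) := by rw [Real.sqrt_mul (sq_nonneg _), Real.sqrt_sq hC]

end ToW

/-! ### §2 The profile of an energy-space element: primitive form and norms -/

section Profile

variable {L : ℝ} (hL : 0 < L)

/-- The profile `u = prim (der p)` of `p ∈ Esp` in the primitive form of record, with its weights, and
`∫ w (u₁² + ¼u²) = ‖p‖²`. [folklore] -/
theorem profile_of_mem (p : Esp L hL) :
    (∀ x, prim (der p) x = prim (der p) 0 + ∫ s in (0 : ℝ)..x, der p s) ∧ (∀ y, prim (der p) (-y) = -prim (der p) y) ∧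
    AEStronglyMeasurable (der p) volume ∧ Integrable (fun y => (L ^ 2 + y ^ 2) * prim (der p) y ^ 2) ∧
    Integrable (fun y => (L ^ 2 + y ^ 2) * der p y ^ 2) ∧
    (∫ y, (L ^ 2 + y ^ 2) * (der p y ^ 2 + 1 / 4 * prim (der p) y ^ 2)) = ‖p‖ ^ 2 := by
  obtain ⟨hu, hodd, hm, h0, h1, e0, e1⟩ := energyClass_of_mem hL p
  refine ⟨hu, hodd, hm, h0, h1, ?_⟩
  have hn : ‖p‖ = ‖((p : Esp L hL) : WithLp 2 (W L × W L))‖ := rfl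
  have hsplit : ∫ y, (L ^ 2 + y ^ 2) * (der p y ^ 2 + 1 / 4 * prim (der p) y ^ 2)
      = (∫ y, (L ^ 2 + y ^ 2) * der p y ^ 2) + 1 / 4 * ∫ y, (L ^ 2 + y ^ 2) * prim (der p) y ^ 2 := by
    rw [← integral_const_mul, ← integral_add h1 (h0.const_mul _)]
    exact integral_congr_ae (Eventually.of_forall fun y => by ring)
  rw [hsplit, der_def, e0, e1, hn, WithLp.prod_norm_sq_eq_of_L2]
  ring

/-- `(∫ w (u₁² + ¼u²))^{1/2} = ‖p‖`. [folklore] -/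
theorem sqrt_energy_eq_norm (p : Esp L hL) :
    Real.sqrt (∫ y, (L ^ 2 + y ^ 2) * (der p y ^ 2 + 1 / 4 * prim (der p) y ^ 2)) = ‖p‖ := by
  rw [(profile_of_mem hL p).2.2.2.2.2, Real.sqrt_sq (norm_nonneg _)]

/-- `(∫ w u²)^{1/2} ≤ 2‖p‖` and `(∫ w u₁²)^{1/2} ≤ ‖p‖`. [folklore] -/
theorem sqrt_weightedSq_profile_le (p : Esp L hL) :
    Real.sqrt (∫ y, (L ^ 2 + y ^ 2) * prim (der p) y ^ 2) ≤ 2 * ‖p‖ ∧ Real.sqrt (∫ y, (L ^ 2 + y ^ 2) * der p y ^ 2) ≤ ‖p‖ := by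
  obtain ⟨-, -, -, h0, h1, -⟩ := profile_of_mem hL p
  simpa only [sqrt_energy_eq_norm hL p] using sqrt_weightedSq_le_energy h0 h1

/-- The profile is `L¹ ∩ L²` with `u₁ ∈ L²` (for the pointwise additivity of `H`, `𝒰`). [folklore] -/
theorem basic_of_mem (p : Esp L hL) :
    MemLp (der p) 2 volume ∧ Integrable (prim (der p)) ∧ MemLp (prim (der p)) 2 volume := by
  obtain ⟨hu, -, hm, h0, h1, -⟩ := profile_of_mem hL p
  obtain ⟨-, h2, h3, h4, -⟩ := basic_of_primitive hL hu hm h0 h1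
  exact ⟨h2, h4, h3⟩

end Profile

/-! ### §3 The nonlocal part `P` of the linearisation as a bounded operator `Esp L hL →L W L` -/

section Pop

variable {L : ℝ} (hL : 0 < L) (lam a : ℝ) {Ω Ω₁ : ℝ → ℝ} {B₀ : ℝ}
  (hΩm : AEStronglyMeasurable Ω volume) (hB₀ : 0 ≤ B₀) (hΩb : ∀ y, |Ω y| ≤ B₀)
  (hΩ₁m : AEStronglyMeasurable Ω₁ volume) (hwΩ₁ : Integrable fun y => (L ^ 2 + y ^ 2) * Ω₁ y ^ 2)

/-- The function `P u = λχ·u + Ω̄·Hu − a·Ω̄₁·𝒰u` of the profile `u = prim (der p)` (`χ = L²/(L²+ξ²)`, `𝒰u = ∫₀ Hu`). [folklore] -/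
def PopFun (L lam a : ℝ) (Ω Ω₁ : ℝ → ℝ) {hL : 0 < L} (p : Esp L hL) (ξ : ℝ) : ℝ :=
  lam * (L ^ 2 / (L ^ 2 + ξ ^ 2)) * prim (der p) ξ + Ω ξ * hilbertTransform (prim (der p)) ξ
    - a * Ω₁ ξ * ∫ s in (0 : ℝ)..ξ, hilbertTransform (prim (der p)) s

include hL hΩm hB₀ hΩb hΩ₁m hwΩ₁ in
/-- The three pieces of `P u` are in `L²_w` with `‖λχu‖_w ≤ |λ|‖u‖_w`, `‖Ω̄·Hu‖_w ≤ B₀‖u‖_w`, `‖aΩ̄₁𝒰u‖_w ≤ |a|(π/(4L))^{1/2}‖u‖_w‖Ω̄₁‖_w`,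
hence `P u ∈ L²(μ_w)` with `‖P u‖_w ≤ 2(|λ| + B₀ + |a|(π/(4L))^{1/2}‖Ω̄₁‖_w)·‖p‖`. [folklore] -/
theorem memLp_PopFun (p : Esp L hL) :
    MemLp (PopFun L lam a Ω Ω₁ p) 2 (μw L) ∧
      Real.sqrt (∫ y, (L ^ 2 + y ^ 2) * PopFun L lam a Ω Ω₁ p y ^ 2) ≤
        2 * (|lam| + B₀ + |a| * Real.sqrt (π / (4 * L)) * Real.sqrt (∫ y, (L ^ 2 + y ^ 2) * Ω₁ y ^ 2)) * ‖p‖ := by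
  obtain ⟨hu, hodd, hm, h0, h1, -⟩ := profile_of_mem hL p
  obtain ⟨hu₁2, hui, hu2⟩ := basic_of_mem hL p
  obtain ⟨hHm, -, hwH, hiso⟩ := weightedSq_hilbertTransform_of_primitive hL hu hodd hm h0 h1
  have huc : Continuous (prim (der p)) := continuous_prim hL _
  have hUc : Continuous fun ξ => ∫ s in (0 : ℝ)..ξ, hilbertTransform (prim (der p)) s :=
    continuous_velocity_of_primitive hu hu₁2 hui hu2
  set sU : ℝ := Real.sqrt (∫ y, (L ^ 2 + y ^ 2) * prim (der p) y ^ 2) with hsU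
  have hsU0 : 0 ≤ sU := Real.sqrt_nonneg _
  have hsUle : sU ≤ 2 * ‖p‖ := (sqrt_weightedSq_profile_le hL p).1
  have hP0 : 0 ≤ Real.sqrt (π / (4 * L)) := Real.sqrt_nonneg _
  have hU : ∀ ξ, |∫ s in (0 : ℝ)..ξ, hilbertTransform (prim (der p)) s| ≤ Real.sqrt (π / (4 * L)) * sU := fun ξ =>
    abs_velocity_le_of_primitive hL hu hodd hm h0 h1 ξ
  -- piece 1: λχu
  set f₁ : ℝ → ℝ := fun ξ => lam * (L ^ 2 / (L ^ 2 + ξ ^ 2)) * prim (der p) ξ with hf₁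
  have hf₁m : AEStronglyMeasurable f₁ volume := by
    have : Continuous f₁ := by
      refine (continuous_const.mul (continuous_const.div (by fun_prop) fun ξ => ?_)).mul huc
      positivity
    exact this.aestronglyMeasurable
  obtain ⟨hf₁i, hf₁b⟩ := weightedSq_le_of_sq_le (L := L) (C := |lam|) hf₁m h0 (abs_nonneg _) fun ξ => by
    have hχ0 : 0 ≤ L ^ 2 / (L ^ 2 + ξ ^ 2) := by positivity
    have hχ1 : L ^ 2 / (L ^ 2 + ξ ^ 2) ≤ 1 := by
      rw [div_le_one (by positivity)]; nlinarith [sq_nonneg ξ]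
    have : (lam * (L ^ 2 / (L ^ 2 + ξ ^ 2))) ^ 2 ≤ |lam| ^ 2 := by
      rw [mul_pow, sq_abs]
      have hχ2 : (L ^ 2 / (L ^ 2 + ξ ^ 2)) ^ 2 ≤ 1 := by nlinarith
      nlinarith [sq_nonneg lam]
    calc f₁ ξ ^ 2 = (lam * (L ^ 2 / (L ^ 2 + ξ ^ 2))) ^ 2 * prim (der p) ξ ^ 2 := by rw [hf₁]; ring
      _ ≤ |lam| ^ 2 * prim (der p) ξ ^ 2 := mul_le_mul_of_nonneg_right this (sq_nonneg _)
  -- piece 2: Ω̄·Hu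
  set f₂ : ℝ → ℝ := fun ξ => Ω ξ * hilbertTransform (prim (der p)) ξ with hf₂
  have hf₂m : AEStronglyMeasurable f₂ volume := hΩm.mul hHm
  obtain ⟨hf₂i, hf₂b⟩ := weightedSq_le_of_sq_le (L := L) (C := B₀) hf₂m hwH hB₀ fun ξ => by
    have h2 : Ω ξ ^ 2 ≤ B₀ ^ 2 := by rw [← sq_abs (Ω ξ)]; exact pow_le_pow_left₀ (abs_nonneg _) (hΩb ξ) 2
    calc f₂ ξ ^ 2 = Ω ξ ^ 2 * hilbertTransform (prim (der p)) ξ ^ 2 := by rw [hf₂]; ring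
      _ ≤ B₀ ^ 2 * hilbertTransform (prim (der p)) ξ ^ 2 := mul_le_mul_of_nonneg_right h2 (sq_nonneg _)
  -- piece 3: aΩ̄₁𝒰u
  set f₃ : ℝ → ℝ := fun ξ => a * Ω₁ ξ * ∫ s in (0 : ℝ)..ξ, hilbertTransform (prim (der p)) s with hf₃
  have hf₃m : AEStronglyMeasurable f₃ volume := (hΩ₁m.const_mul a).mul hUc.aestronglyMeasurable
  obtain ⟨hf₃i, hf₃b⟩ := weightedSq_le_of_sq_le (L := L) (C := |a| * (Real.sqrt (π / (4 * L)) * sU)) hf₃m hwΩ₁ (by positivity)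
    fun ξ => by
    have h3 : (a * ∫ s in (0 : ℝ)..ξ, hilbertTransform (prim (der p)) s) ^ 2 ≤ (|a| * (Real.sqrt (π / (4 * L)) * sU)) ^ 2 := by
      rw [← sq_abs (a * _), abs_mul]
      exact pow_le_pow_left₀ (by positivity) (mul_le_mul_of_nonneg_left (hU ξ) (abs_nonneg a)) 2
    calc f₃ ξ ^ 2 = (a * ∫ s in (0 : ℝ)..ξ, hilbertTransform (prim (der p)) s) ^ 2 * Ω₁ ξ ^ 2 := by rw [hf₃]; ring
      _ ≤ (|a| * (Real.sqrt (π / (4 * L)) * sU)) ^ 2 * Ω₁ ξ ^ 2 := mul_le_mul_of_nonneg_right h3 (sq_nonneg _)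
  -- assemble
  have e : PopFun L lam a Ω Ω₁ p = fun ξ => (f₁ ξ + f₂ ξ) - f₃ ξ := by
    funext ξ; simp only [PopFun, hf₁, hf₂, hf₃]
  have hm₁ := memLp_W hf₁m hf₁i; have hm₂ := memLp_W hf₂m hf₂i; have hm₃ := memLp_W hf₃m hf₃i
  have hmem : MemLp (PopFun L lam a Ω Ω₁ p) 2 (μw L) := by rw [e]; exact (hm₁.add hm₂).sub hm₃
  refine ⟨hmem, ?_⟩
  -- the weighted norm of the sum through the `W L` triangle inequality
  have hn := (norm_toLp_W hL hmem).2
  have hsum : (hmem.toLp (PopFun L lam a Ω Ω₁ p) : W L) = hm₁.toLp f₁ + hm₂.toLp f₂ - hm₃.toLp f₃ := by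
    rw [← MemLp.toLp_add, ← MemLp.toLp_sub]
    exact MemLp.toLp_congr _ _ (Eventually.of_forall fun ξ => by rw [e]; rfl)
  rw [← hn, hsum]
  have hn₁ := (norm_toLp_W hL hm₁).2; have hn₂ := (norm_toLp_W hL hm₂).2; have hn₃ := (norm_toLp_W hL hm₃).2
  have hwΩ₁0 : 0 ≤ Real.sqrt (∫ y, (L ^ 2 + y ^ 2) * Ω₁ y ^ 2) := Real.sqrt_nonneg _
  calc ‖(hm₁.toLp f₁ + hm₂.toLp f₂ - hm₃.toLp f₃ : W L)‖ ≤ ‖(hm₁.toLp f₁ : W L)‖ + ‖(hm₂.toLp f₂ : W L)‖ + ‖(hm₃.toLp f₃ : W L)‖ :=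
        (norm_sub_le _ _).trans (add_le_add (norm_add_le _ _) le_rfl)
    _ ≤ |lam| * sU + B₀ * Real.sqrt (∫ y, (L ^ 2 + y ^ 2) * hilbertTransform (prim (der p)) y ^ 2)
          + |a| * (Real.sqrt (π / (4 * L)) * sU) * Real.sqrt (∫ y, (L ^ 2 + y ^ 2) * Ω₁ y ^ 2) := by
        rw [hn₁, hn₂, hn₃]; exact add_le_add (add_le_add hf₁b hf₂b) hf₃b
    _ = (|lam| + B₀ + |a| * Real.sqrt (π / (4 * L)) * Real.sqrt (∫ y, (L ^ 2 + y ^ 2) * Ω₁ y ^ 2)) * sU := by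
        rw [hiso]; ring
    _ ≤ (|lam| + B₀ + |a| * Real.sqrt (π / (4 * L)) * Real.sqrt (∫ y, (L ^ 2 + y ^ 2) * Ω₁ y ^ 2)) * (2 * ‖p‖) :=
        mul_le_mul_of_nonneg_left hsUle (by positivity)
    _ = 2 * (|lam| + B₀ + |a| * Real.sqrt (π / (4 * L)) * Real.sqrt (∫ y, (L ^ 2 + y ^ 2) * Ω₁ y ^ 2)) * ‖p‖ := by ring

/-- `P` is additive on profiles, pointwise (additivity of `H` and `𝒰` on the class). [folklore] -/
theorem PopFun_add (p q : Esp L hL) :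
    PopFun L lam a Ω Ω₁ (p + q) = fun ξ => PopFun L lam a Ω Ω₁ p ξ + PopFun L lam a Ω Ω₁ q ξ := by
  obtain ⟨hu, -, -, -, -, -⟩ := profile_of_mem hL p
  obtain ⟨hu₁2, hui, hu2⟩ := basic_of_mem hL p
  obtain ⟨hv, -, -, -, -, -⟩ := profile_of_mem hL q
  obtain ⟨hv₁2, hvi, hv2⟩ := basic_of_mem hL q
  have hsum := (der_add hL p q).2
  funext ξ
  simp only [PopFun]
  rw [hsum, hilbertTransform_add_of_primitive hu hu₁2 hui hv hv₁2 hvi ξ, velocity_add_of_primitive hu hu₁2 hui hu2 hv hv₁2 hvi hv2 ξ]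
  ring

/-- `P` is homogeneous on profiles, pointwise. [folklore] -/
theorem PopFun_smul (c : ℝ) (p : Esp L hL) :
    PopFun L lam a Ω Ω₁ (c • p) = fun ξ => c * PopFun L lam a Ω Ω₁ p ξ := by
  have hH : hilbertTransform (fun x => c * prim (der p) x) = fun x => c * hilbertTransform (prim (der p)) x :=
    funext fun x => hilbertTransform_const_mul c _ x
  funext ξ
  simp only [PopFun, (der_smul hL c p).2, hH, intervalIntegral.integral_const_mul]
  ring

/-- **The nonlocal part as a bounded operator** `Pop : Esp L hL →L[ℝ] W L`, `p ↦ λχ·u + Ω̄·Hu − a·Ω̄₁·𝒰u` (as an `L²_w` class), for a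
bounded a.e.-strongly measurable `Ω̄` and `Ω̄₁` with `∫ w Ω̄₁² < ∞`. [folklore] -/
def Pop : Esp L hL →L[ℝ] W L :=
  LinearMap.mkContinuous
    { toFun := fun p => (memLp_PopFun hL lam a hΩm hB₀ hΩb hΩ₁m hwΩ₁ p).1.toLp (PopFun L lam a Ω Ω₁ p)
      map_add' := fun p q => by
        rw [← MemLp.toLp_add]
        exact MemLp.toLp_congr _ _ (Eventually.of_forall fun ξ => by
          rw [PopFun_add hL lam a p q]; rfl)
      map_smul' := fun c p => by
        rw [RingHom.id_apply, ← MemLp.toLp_const_smul]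
        exact MemLp.toLp_congr _ _ (Eventually.of_forall fun ξ => by
          rw [PopFun_smul hL lam a c p]; rfl) }
    (2 * (|lam| + B₀ + |a| * Real.sqrt (π / (4 * L)) * Real.sqrt (∫ y, (L ^ 2 + y ^ 2) * Ω₁ y ^ 2)))
    fun p => by
      simp only [LinearMap.coe_mk, AddHom.coe_mk]
      rw [(norm_toLp_W hL (memLp_PopFun hL lam a hΩm hB₀ hΩb hΩ₁m hwΩ₁ p).1).2]
      exact (memLp_PopFun hL lam a hΩm hB₀ hΩb hΩ₁m hwΩ₁ p).2

/-- `Pop p` is the `L²_w` class of the function `P u`: a.e. equality and the norm bound. [folklore] -/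
theorem Pop_apply (p : Esp L hL) :
    (((Pop hL lam a hΩm hB₀ hΩb hΩ₁m hwΩ₁ p : W L) : ℝ → ℝ) =ᵐ[volume] PopFun L lam a Ω Ω₁ p) ∧
      ‖Pop hL lam a hΩm hB₀ hΩb hΩ₁m hwΩ₁ p‖ ≤
        2 * (|lam| + B₀ + |a| * Real.sqrt (π / (4 * L)) * Real.sqrt (∫ y, (L ^ 2 + y ^ 2) * Ω₁ y ^ 2)) * ‖p‖ := by
  have h := norm_toLp_W hL (memLp_PopFun hL lam a hΩm hB₀ hΩb hΩ₁m hwΩ₁ p).1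
  refine ⟨h.1, ?_⟩
  show ‖((memLp_PopFun hL lam a hΩm hB₀ hΩb hΩ₁m hwΩ₁ p).1.toLp (PopFun L lam a Ω Ω₁ p) : W L)‖ ≤ _
  rw [h.2]; exact (memLp_PopFun hL lam a hΩm hB₀ hΩb hΩ₁m hwΩ₁ p).2

end Pop

/-! ### §4 The quadratic part `Q u v = a·𝒰u·v₁ − Hu·v` as a bounded bilinear operator `Esp L hL →L Esp L hL →L W L` -/

section Qop

variable {L : ℝ} (hL : 0 < L) (a : ℝ)

/-- PRICE (C4)'s constant in the `L²_w` pivot: `M_w = 2|a|(π/(4L))^{1/2} + 2√2/L` (`= M/2`, `L_lip = 2M = 4M_w`). [folklore] -/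
def Mw (L a : ℝ) : ℝ := 2 * |a| * Real.sqrt (π / (4 * L)) + 2 * Real.sqrt 2 / L

/-- The function `Q u v = a·𝒰u·v₁ − Hu·v` of the profiles `u = prim (der p)`, `v = prim (der q)`, `v₁ = der q`. [folklore] -/
def QFun (L a : ℝ) {hL : 0 < L} (p q : Esp L hL) (ξ : ℝ) : ℝ :=
  a * (∫ s in (0 : ℝ)..ξ, hilbertTransform (prim (der p)) s) * der q ξ - hilbertTransform (prim (der p)) ξ * prim (der q) ξ

include hL in
/-- `Q u v ∈ L²(μ_w)` with `(∫ w (Q u v)²)^{1/2} ≤ M_w‖p‖‖q‖` (`SheetREnergyClass.sqrt_weightedSq_quadratic_le` + `∫w(u₁² + ¼u²) = ‖p‖²`). [folklore] -/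
theorem memLp_QFun (p q : Esp L hL) :
    MemLp (QFun L a p q) 2 (μw L) ∧ Real.sqrt (∫ y, (L ^ 2 + y ^ 2) * QFun L a p q y ^ 2) ≤ Mw L a * ‖p‖ * ‖q‖ := by
  obtain ⟨hu, hodd, hm, h0, h1, -⟩ := profile_of_mem hL p
  obtain ⟨hu₁2, hui, hu2⟩ := basic_of_mem hL p
  obtain ⟨hv, -, hvm, hv0, hv1, -⟩ := profile_of_mem hL q
  obtain ⟨hHm, -, -, -⟩ := weightedSq_hilbertTransform_of_primitive hL hu hodd hm h0 h1
  have hUc : Continuous fun ξ => ∫ s in (0 : ℝ)..ξ, hilbertTransform (prim (der p)) s :=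
    continuous_velocity_of_primitive hu hu₁2 hui hu2
  have hvc : Continuous (prim (der q)) := continuous_prim hL _
  obtain ⟨hint, hle⟩ := sqrt_weightedSq_quadratic_le (a := a) hL hu hodd hm h0 h1 hv hvm hv0 hv1
  have hQm : AEStronglyMeasurable (QFun L a p q) volume :=
    (((continuous_const.mul hUc).aestronglyMeasurable).mul hvm).sub (hHm.mul hvc.aestronglyMeasurable)
  refine ⟨memLp_W hQm hint, ?_⟩
  calc Real.sqrt (∫ y, (L ^ 2 + y ^ 2) * QFun L a p q y ^ 2)
      ≤ (2 * |a| * Real.sqrt (π / (4 * L)) + 2 * Real.sqrt 2 / L)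
          * Real.sqrt (∫ y, (L ^ 2 + y ^ 2) * (der p y ^ 2 + 1 / 4 * prim (der p) y ^ 2))
          * Real.sqrt (∫ y, (L ^ 2 + y ^ 2) * (der q y ^ 2 + 1 / 4 * prim (der q) y ^ 2)) := hle
    _ = Mw L a * ‖p‖ * ‖q‖ := by rw [sqrt_energy_eq_norm hL p, sqrt_energy_eq_norm hL q]; rfl

include hL in
/-- `Q` is additive in the first (profile) slot, pointwise. [folklore] -/
theorem QFun_add_left (p p' q : Esp L hL) : QFun L a (p + p') q = fun ξ => QFun L a p q ξ + QFun L a p' q ξ := by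
  obtain ⟨hu, -, -, -, -, -⟩ := profile_of_mem hL p
  obtain ⟨hu₁2, hui, hu2⟩ := basic_of_mem hL p
  obtain ⟨hv, -, -, -, -, -⟩ := profile_of_mem hL p'
  obtain ⟨hv₁2, hvi, hv2⟩ := basic_of_mem hL p'
  have hsum := (der_add hL p p').2
  funext ξ
  simp only [QFun]
  rw [hsum, hilbertTransform_add_of_primitive hu hu₁2 hui hv hv₁2 hvi ξ, velocity_add_of_primitive hu hu₁2 hui hu2 hv hv₁2 hvi hv2 ξ]
  ring

include hL in
/-- `Q` is homogeneous in the first slot, pointwise. [folklore] -/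
theorem QFun_smul_left (c : ℝ) (p q : Esp L hL) : QFun L a (c • p) q = fun ξ => c * QFun L a p q ξ := by
  have hH : hilbertTransform (fun x => c * prim (der p) x) = fun x => c * hilbertTransform (prim (der p)) x :=
    funext fun x => hilbertTransform_const_mul c _ x
  funext ξ
  simp only [QFun, (der_smul hL c p).2, hH, intervalIntegral.integral_const_mul]
  ring

include hL in
/-- `Q` is additive in the second slot, almost everywhere (`der (q + q') = der q + der q'` a.e.). [folklore] -/
theorem QFun_add_right (p q q' : Esp L hL) : QFun L a p (q + q') =ᵐ[volume] fun ξ => QFun L a p q ξ + QFun L a p q' ξ := by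
  obtain ⟨hae, hprim⟩ := der_add hL q q'
  filter_upwards [hae] with ξ hξ
  simp only [QFun, hξ, hprim]
  ring

include hL in
/-- `Q` is homogeneous in the second slot, almost everywhere. [folklore] -/
theorem QFun_smul_right (c : ℝ) (p q : Esp L hL) : QFun L a p (c • q) =ᵐ[volume] fun ξ => c * QFun L a p q ξ := by
  obtain ⟨hae, hprim⟩ := der_smul hL c q
  filter_upwards [hae] with ξ hξ
  simp only [QFun, hξ, hprim]
  ring

/-- **The quadratic part as a bounded bilinear operator** `Qop : Esp L hL →L[ℝ] Esp L hL →L[ℝ] W L`, `(p, q) ↦ a·𝒰u·v₁ − Hu·v` (as an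
`L²_w` class), with `‖Qop p q‖ ≤ M_w‖p‖‖q‖`. [folklore] -/
def Qop : Esp L hL →L[ℝ] Esp L hL →L[ℝ] W L :=
  LinearMap.mkContinuous₂
    (LinearMap.mk₂ ℝ (fun p q => ((memLp_QFun hL a p q).1.toLp (QFun L a p q) : W L))
      (fun p p' q => by
        rw [← MemLp.toLp_add]
        exact MemLp.toLp_congr _ _ (Eventually.of_forall fun ξ => by rw [QFun_add_left hL a p p' q]; rfl))
      (fun c p q => by
        rw [← MemLp.toLp_const_smul]
        exact MemLp.toLp_congr _ _ (Eventually.of_forall fun ξ => by rw [QFun_smul_left hL a c p q]; rfl))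
      (fun p q q' => by
        rw [← MemLp.toLp_add]
        exact MemLp.toLp_congr _ _ (ae_μw_of_ae_volume (QFun_add_right hL a p q q')))
      (fun c p q => by
        rw [← MemLp.toLp_const_smul]
        exact MemLp.toLp_congr _ _ (ae_μw_of_ae_volume (QFun_smul_right hL a c p q))))
    (Mw L a) fun p q => by
      simp only [LinearMap.mk₂_apply]
      rw [(norm_toLp_W hL (memLp_QFun hL a p q).1).2]
      exact (memLp_QFun hL a p q).2

/-- `Qop p q` is the `L²_w` class of the function `Q u v`: a.e. equality and the bilinear bound. [folklore] -/
theorem Qop_apply (p q : Esp L hL) :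
    ((((Qop hL a p q : W L)) : ℝ → ℝ) =ᵐ[volume] QFun L a p q) ∧ ‖Qop hL a p q‖ ≤ Mw L a * ‖p‖ * ‖q‖ := by
  have h := norm_toLp_W hL (memLp_QFun hL a p q).1
  have e : (Qop hL a p q : W L) = (memLp_QFun hL a p q).1.toLp (QFun L a p q) := by
    simp only [Qop, LinearMap.mkContinuous₂_apply, LinearMap.mk₂_apply]
  rw [e]
  exact ⟨h.1, by rw [h.2]; exact (memLp_QFun hL a p q).2⟩

/-- `M_w ≥ 0`. [folklore] -/
theorem Mw_nonneg {L : ℝ} (hL : 0 < L) (a : ℝ) : 0 ≤ Mw L a := by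
  unfold Mw; positivity

end Qop

/-! ### §5 The kernel inequality `4·M_w ≤ L_lip` at the frame's `(L, a) = (8, 1/5)` -/

/-- **`4·M_w ≤ Llip`** at `L = 8`, `a = 1/5`: `4M_w = (8/5)(π/32)^{1/2} + √2 ≤ 1.6·0.31332856 + 1.414213563 = 1.915539… ≤ 95777/50000`
(Mathlib's `π < 3.141593`; margin ≈ 7·10⁻⁷). So the row's hypothesis `4·M_w ≤ Llip` of `existsUnique_fixedPoint_of_row_w` holds for the
sheet's own quadratic part. [folklore] -/
theorem four_Mw_le_Llip : 4 * Mw 8 (1 / 5) ≤ ((CertificateViscousSheetR.Llip : ℚ) : ℝ) := by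
  have hπ : π / (4 * 8) ≤ (31332856 / 100000000 : ℝ) ^ 2 := by
    have := Real.pi_lt_d6; nlinarith
  have h1 : Real.sqrt (π / (4 * 8)) ≤ 31332856 / 100000000 := Real.sqrt_le_iff.2 ⟨by norm_num, hπ⟩
  have h2 : Real.sqrt 2 ≤ 1414213563 / 1000000000 := Real.sqrt_le_iff.2 ⟨by norm_num, by norm_num⟩
  have hL : (CertificateViscousSheetR.Llip : ℝ) = 95777 / 50000 := by norm_num [CertificateViscousSheetR.Llip]
  rw [hL, Mw, show |(1 / 5 : ℝ)| = 1 / 5 by norm_num]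
  nlinarith [h1, h2, Real.sqrt_nonneg (π / (4 * 8)), Real.sqrt_nonneg (2 : ℝ)]

end SheetRAssemblyOperators
end Summit.NavierStokesRegularity.OSWSelfSimilar

end
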